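import Summits.BirchSwinnertonDyer.BirchSwinnertonDyer.Theorems.SignedLowerHalvesSmallImageLowerHalfBothSignsRttD2SeqJ3TracePairing
import Summits.BirchSwinnertonDyer.BirchSwinnertonDyer.Theorems.SignedLowerHalvesSmallImageLowerHalfBothSignsRttD2SeqJ3TorsionLevels
import Literature.NumberTheory.EllipticCurves.GreenbergSelmerCofreeReductionPk
import HarnessLib

/-!
# Route `SignedLowerHalves`, crux L `SmallImageLowerHalfBothSigns` (stmt-BirchSwinnertonDyer-23599), line `rtt_w3` v14 → v15 — E2, row J3 (Galois side, part β₃d, stage 2):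
# THE TRACE PAIRING ON THE TORSION LEVELS `M[p^k]` OF THE LEAD's MODULE `M = (F/𝒪)(θ) = GreenbergSelmer.Cofree θ F` (rank one):
# `M[p^k] = p^{-k}𝒪/𝒪 ≅ 𝒪/p^k` (coordinates), `⟪w, m⟫_k := Tr(a·x)·ζ` for `w = a ⊗ ζ`, `m = x/p^k`; its `𝒪`-balance, level law and Galois twist law

WIDTH seat `bsd-line-slh-p3-w3` g22 under LEAD `cruxlead-stmt-BirchSwinnertonDyer-23599` g11 (cell `bsd-ssimc`); helper `--supports stmt-BirchSwinnertonDyer-23599`.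
DEFINITIONS WITH BODIES + THEOREMS; no named fact, no instance, no `sorry`. HONEST FRAMING: stage 2 of input (β₃d) for `exists_junction_exact_of_inputs` (p790304) — the coefficient
pairing on the torsion level `M[p^k]` of the LEAD's `M = Cofree θ (padicCoeffField S)` (`θ : FramedGaloisRep K 𝒪 1`, consumer p784278); stage 3 (packaging as the `ContPairing`
binder `Pk` over `Γ_{K_v}` with `hPred`/`hPsc`) is the sequel. E2, crux L/M, BSD remain OPEN and are proved for NO curve.

* §1 coordinates of `M[p^k]`: `exists_divPowTors_eq` (every `p^k`-torsion class is `t/p^k`), `exists_eq_pow_mul_of_divPowCofreeMk_eq_zero` (`t/p^k ≡ 0 ⇒ t ∈ p^k𝒪`),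
  `tracePairing_eq_of_divPowCofreeMk_eq` (the trace pairing only depends on `t/p^k`).
* §2 ★ `cofreeTracePairing S K θ k : OMuCarrier K S (p^k) →+ (M[p^k] →+ μ_{p^k})`, `cofreeTracePairing_divPowTors` (`= Tr(a t)·ζ` on `t/p^k`).
* §3 laws: ★ `cofreeTracePairing_oMuScalar` (`𝒪`-balance, the shape of `hPsc`), ★ `muInclusion_cofreeTracePairing_oMuRed` (level law, the shape of `hPred`),
  ★ `cofreeTracePairing_muTwistO_smul` (Galois: `⟪σ·w, σ·m⟫ = σ·⟪w, m⟫` whenever `θ′(σ)·θ(σ) = 1`).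
References: [Rubin2000] §4.2; [NeukirchSchmidtWingberg2008] (7.2.6); [Kato2004Asterisque] §13.8; [Greenberg1989] §1; [EmertonPollackWeston2006] §3.1.
-/

set_option autoImplicit false
set_option linter.dupNamespace false -- D-0017: single-problem summit, the namespace repeats the problem name by design
noncomputable section

open scoped Classical
open NumberField IsDedekindDomain Field Matrix

namespace Summit.BirchSwinnertonDyer.BirchSwinnertonDyer.Theorems.SmallImageRttD2Seq

open Literature.NumberTheory.EllipticCurves Literature.NumberTheory.EllipticCurves.GreenbergSelmer Literature.NumberTheory.GaloisRepresentations
  Literature.NumberTheory.GaloisRepresentations.DiscreteGaloisModule Literature.NumberTheory.ComplexMultiplication.EllipticUnits.JohnsonLeungKings2011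

section Cofree

variable {p : ℕ} [Fact p.Prime] (S : Set (PadicAlgCl p)) (K : Type) [Field K] (θ : FramedGaloisRep K (padicCoeffIntegers S) 1) (k : ℕ)

/-! ## §1. Coordinates of `M[p^k]` -/

/-- The structure map `𝒪 → F = ℚ_p(S)` is the inclusion (on `ℚ̄_p`). [folklore] -/
theorem coe_algebraMap_padicCoeffIntegers' (x : padicCoeffIntegers S) :
    ((algebraMap (padicCoeffIntegers S) (padicCoeffField S) x : padicCoeffField S) : PadicAlgCl p) = (x : PadicAlgCl p) :=
  rfl

/-- `𝒪 → F` is injective. [folklore] -/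
theorem algebraMap_padicCoeffIntegers_injective : Function.Injective (algebraMap (padicCoeffIntegers S) (padicCoeffField S)) :=
  fun x y h ↦ Subtype.ext (by rw [← coe_algebraMap_padicCoeffIntegers' S x, ← coe_algebraMap_padicCoeffIntegers' S y, h])

/-- **`t ↦ t/p^k : 𝒪ⁿ → M[p^k]`** (the tree's `divPowCofreeMk`, valued in the `p^k`-torsion; the tree's `divPowCofreeMkTorsion` is the case `K = ℚ`).
[cite: Kato2004Asterisque, §13.8 (p. 228)] -/
def divPowTors : (Fin 1 → padicCoeffIntegers S) →+ ↥(torsionPow (Cofree θ (padicCoeffField S)) p k) where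
  toFun t := ⟨divPowCofreeMk S θ k t, by
    rw [mem_torsionPow_iff, pow_smul_divPowCofreeMk]⟩
  map_zero' := Subtype.ext (map_zero _)
  map_add' s t := Subtype.ext (map_add _ s t)

/-- Unfolding `divPowTors`. [folklore] -/
theorem coe_divPowTors_apply (t : Fin 1 → padicCoeffIntegers S) :
    ((divPowTors S K θ k t : ↥(torsionPow (Cofree θ (padicCoeffField S)) p k)) : Cofree θ (padicCoeffField S)) = divPowCofreeMk S θ k t :=
  rfl

/-- **Every `p^k`-torsion class of `F/𝒪` is `t/p^k` for some `t ∈ 𝒪`** (surjectivity of the tree's `divPowCofreeMkTorsion`). [cite: Kato2004Asterisque, §13.8 (p. 228)]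
[cite: Greenberg1989, §1 p. 98] -/
theorem exists_divPowTors_eq (m : ↥(torsionPow (Cofree θ (padicCoeffField S)) p k)) :
    ∃ t : Fin 1 → padicCoeffIntegers S, divPowTors S K θ k t = m := by
  obtain ⟨m, hm⟩ := m
  obtain ⟨f, rfl⟩ := cofreeMk_surjective (padicCoeffField S) θ m
  have hm' : ((p ^ k : ℕ) : padicCoeffField S) • f ∈ lattice 1 (padicCoeffIntegers S) (padicCoeffField S) := by
    rw [← ker_cofreeMk (padicCoeffField S) θ, LinearMap.mem_ker, Nat.cast_smul_eq_nsmul, map_nsmul]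
    exact (mem_torsionPow_iff _ _).mp hm
  obtain ⟨t, ht⟩ := (mem_lattice_iff _).mp hm'
  refine ⟨t, Subtype.ext ?_⟩
  have hp : (p : padicCoeffField S) ≠ 0 := Nat.cast_ne_zero.mpr (Fact.out : p.Prime).ne_zero
  rw [coe_divPowTors_apply, divPowCofreeMk_apply, ht, smul_smul, Nat.cast_pow, ← mul_pow, inv_mul_cancel₀ hp, one_pow, one_smul]

/-- **`t/p^k ≡ 0 (mod 𝒪) ⇒ t ∈ p^k 𝒪`.** [cite: Kato2004Asterisque, §13.8 (p. 228)] -/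
theorem exists_eq_pow_mul_of_divPowCofreeMk_eq_zero (t : Fin 1 → padicCoeffIntegers S) (ht : divPowCofreeMk S θ k t = 0) :
    ∃ s : padicCoeffIntegers S, t 0 = ((p : ℕ) : padicCoeffIntegers S) ^ k * s := by
  rw [divPowCofreeMk_apply, ← LinearMap.mem_ker, ker_cofreeMk, mem_lattice_iff] at ht
  obtain ⟨s, hs⟩ := ht
  refine ⟨s 0, algebraMap_padicCoeffIntegers_injective S ?_⟩
  have hp : (p : padicCoeffField S) ≠ 0 := Nat.cast_ne_zero.mpr (Fact.out : p.Prime).ne_zero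
  have h0 := congrFun hs 0
  simp only [Pi.smul_apply, smul_eq_mul] at h0
  rw [map_mul, map_pow, map_natCast, h0, ← mul_assoc, ← mul_pow, mul_inv_cancel₀ hp, one_pow, one_mul]

/-- The trace pairing (stage 1, p791019) depends on `t ∈ 𝒪` only through `t/p^k ∈ F/𝒪`. [cite: Rubin2000, §4.2] -/
theorem tracePairing_eq_of_divPowCofreeMk_eq (w : OMuCarrier K S (p ^ k)) (t t' : Fin 1 → padicCoeffIntegers S)
    (h : divPowCofreeMk S θ k t = divPowCofreeMk S θ k t') : tracePairing S K k w (t 0) = tracePairing S K k w (t' 0) := by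
  have h0 : divPowCofreeMk S θ k (t - t') = 0 := by rw [map_sub, h, sub_self]
  obtain ⟨s, hs⟩ := exists_eq_pow_mul_of_divPowCofreeMk_eq_zero S K θ k (t - t') h0
  rw [← sub_eq_zero, ← map_sub, show t 0 - t' 0 = (t - t') 0 from rfl, hs, tracePairing_natCast_pow_mul]

/-! ## §2. The pairing on `M[p^k]` -/

/-- A coordinate `t ∈ 𝒪` of a torsion class `m = t/p^k` (a choice; the pairing does not depend on it). [cite: Kato2004Asterisque, §13.8] -/
def torsCoord (m : ↥(torsionPow (Cofree θ (padicCoeffField S)) p k)) : Fin 1 → padicCoeffIntegers S :=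
  (exists_divPowTors_eq S K θ k m).choose

/-- `torsCoord m / p^k = m`. [cite: Kato2004Asterisque, §13.8] -/
theorem divPowTors_torsCoord (m : ↥(torsionPow (Cofree θ (padicCoeffField S)) p k)) : divPowTors S K θ k (torsCoord S K θ k m) = m :=
  (exists_divPowTors_eq S K θ k m).choose_spec

/-- ★ **The trace pairing on the torsion level `M[p^k] = (p^{-k}𝒪/𝒪)(θ)`**: `⟪a ⊗ ζ, t/p^k⟫_k = Tr_{𝒪/ℤ_p}(a t)·ζ`. [cite: Rubin2000, §4.2] [cite: NeukirchSchmidtWingberg2008, (7.2.6)] -/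
def cofreeTracePairing : OMuCarrier K S (p ^ k) →+ (↥(torsionPow (Cofree θ (padicCoeffField S)) p k) →+ MuCarrier K (p ^ k)) where
  toFun w :=
    { toFun := fun m ↦ tracePairing S K k w (torsCoord S K θ k m 0)
      map_zero' := by
        rw [tracePairing_eq_of_divPowCofreeMk_eq S K θ k w (torsCoord S K θ k 0) 0
          (by rw [← coe_divPowTors_apply, ← coe_divPowTors_apply, divPowTors_torsCoord, map_zero])]
        change tracePairing S K k w 0 = 0
        exact map_zero _
      map_add' := fun m m' ↦ by
        rw [tracePairing_eq_of_divPowCofreeMk_eq S K θ k w (torsCoord S K θ k (m + m')) (torsCoord S K θ k m + torsCoord S K θ k m')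
          (by rw [← coe_divPowTors_apply, ← coe_divPowTors_apply, divPowTors_torsCoord, map_add,
            divPowTors_torsCoord, divPowTors_torsCoord])]
        exact map_add _ _ _ }
  map_zero' := AddMonoidHom.ext fun m ↦ by
    show tracePairing S K k 0 (torsCoord S K θ k m 0) = 0
    rw [map_zero, AddMonoidHom.zero_apply]
  map_add' := fun w w' ↦ AddMonoidHom.ext fun m ↦ by
    show tracePairing S K k (w + w') (torsCoord S K θ k m 0) = tracePairing S K k w (torsCoord S K θ k m 0) + tracePairing S K k w' (torsCoord S K θ k m 0)
    rw [map_add, AddMonoidHom.add_apply]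

/-- ★ **`⟪w, t/p^k⟫_k = (w, t)_k`**: the torsion-level pairing on the class of `t` is the coordinate trace pairing at `t`. [cite: Rubin2000, §4.2] -/
theorem cofreeTracePairing_divPowTors (w : OMuCarrier K S (p ^ k)) (t : Fin 1 → padicCoeffIntegers S) :
    cofreeTracePairing S K θ k w (divPowTors S K θ k t) = tracePairing S K k w (t 0) :=
  tracePairing_eq_of_divPowCofreeMk_eq S K θ k w _ _ (by
    rw [← coe_divPowTors_apply, ← coe_divPowTors_apply, divPowTors_torsCoord])

/-! ## §3. The laws on `M[p^k]` -/

/-- `c • (t/p^k) = (c t)/p^k` on the torsion level. [folklore] -/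
theorem smul_divPowTors (c : padicCoeffIntegers S) (t : Fin 1 → padicCoeffIntegers S) :
    c • divPowTors S K θ k t = divPowTors S K θ k (c • t) := by
  apply Subtype.ext
  rw [coe_smul_torsionPow, coe_divPowTors_apply, coe_divPowTors_apply, divPowCofreeMk_apply, divPowCofreeMk_apply, ← map_smul, smul_comm]
  congr 2

/-- ★ **`𝒪`-balance on `M[p^k]`**: `⟪(c ⊗ id) w, m⟫ = ⟪w, c·m⟫` (the shape of the binder `hPsc`). [cite: Rubin2000, §4.2] -/
theorem cofreeTracePairing_oMuScalar (c : padicCoeffIntegers S) (w : OMuCarrier K S (p ^ k)) (m : ↥(torsionPow (Cofree θ (padicCoeffField S)) p k)) :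
    cofreeTracePairing S K θ k (oMuScalar S (p ^ k) c w) m = cofreeTracePairing S K θ k w (c • m) := by
  obtain ⟨t, rfl⟩ := exists_divPowTors_eq S K θ k m
  rw [smul_divPowTors, cofreeTracePairing_divPowTors, cofreeTracePairing_divPowTors, tracePairing_oMuScalar]
  rfl

/-- The inclusion `M[p^k] ⊆ M[p^{k+1}]` in coordinates: `t/p^k = (p t)/p^{k+1}`. [cite: Kato2004Asterisque, §13.8 (p. 228)] -/
theorem inclusion_divPowTors (t : Fin 1 → padicCoeffIntegers S) :
    AddSubgroup.inclusion (torsionPow_mono (M := Cofree θ (padicCoeffField S)) (p := p) (Nat.le_succ k)) (divPowTors S K θ k t) =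
      divPowTors S K θ (k + 1) (p • t) := by
  apply Subtype.ext
  change divPowCofreeMk S θ k t = divPowCofreeMk S θ (k + 1) (p • t)
  rw [map_nsmul, smul_divPowCofreeMk_succ]

/-- ★ **Level law on `M[p^k]`**: `ι(⟪red w, m⟫_k) = ⟪w, incl m⟫_{k+1}` (`red = id ⊗ (ζ ↦ ζ^p)`, `ι : μ_{p^k} ⊆ μ_{p^{k+1}}`, `incl : M[p^k] ⊆ M[p^{k+1}]`) — the shape of the binder `hPred`.
[cite: NeukirchSchmidtWingberg2008, (7.1.4), (7.2.6)] -/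
theorem muInclusion_cofreeTracePairing_oMuRed (w : OMuCarrier K S (p ^ (k + 1))) (m : ↥(torsionPow (Cofree θ (padicCoeffField S)) p k)) :
    (haveI : NeZero (p ^ k) := ⟨pow_ne_zero _ (Fact.out : p.Prime).ne_zero⟩
     haveI : NeZero (p ^ (k + 1)) := ⟨pow_ne_zero _ (Fact.out : p.Prime).ne_zero⟩
     muInclusion K (pow_dvd_pow p (Nat.le_succ k)) (cofreeTracePairing S K θ k (oMuRed S k w) m)) =
      cofreeTracePairing S K θ (k + 1) w (AddSubgroup.inclusion (torsionPow_mono (M := Cofree θ (padicCoeffField S)) (p := p) (Nat.le_succ k)) m) := by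
  obtain ⟨t, rfl⟩ := exists_divPowTors_eq S K θ k m
  rw [inclusion_divPowTors, cofreeTracePairing_divPowTors, cofreeTracePairing_divPowTors, muInclusion_tracePairing_oMuRed,
    Pi.smul_apply, nsmul_eq_mul]

/-- `σ • (t/p^k) = (θ(σ)t)/p^k` on the torsion level (rank one: `θ(σ)` acts by its entry). [cite: EmertonPollackWeston2006, §3.1] -/
theorem smul_divPowTors_gal (σ : absoluteGaloisGroup K) (t : Fin 1 → padicCoeffIntegers S) :
    σ • divPowTors S K θ k t =
      divPowTors S K θ k (((θ σ : GL (Fin 1) (padicCoeffIntegers S)) : Matrix (Fin 1) (Fin 1) (padicCoeffIntegers S)) *ᵥ t) := by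
  apply Subtype.ext
  change σ • divPowCofreeMk S θ k t = divPowCofreeMk S θ k _
  rw [divPowCofreeMk_smul]

/-- ★ **Galois twist law on `M[p^k]`**: if `θ′(σ)·θ(σ)₀₀ = 1` then `⟪σ·w, σ·m⟫ = σ·⟪w, m⟫` (`σ` acting on `𝒪 ⊗ μ ⊗ θ′` by honda's `muTwistO`, on `M[p^k]` through `θ`, on `μ`
through `mu`) — the equivariance making `⟪·,·⟫` a pairing of Galois modules `X_k × M[p^k] → μ_{p^k}`. [cite: Rubin2000, §4.2] [cite: NeukirchSchmidtWingberg2008, (7.2.6)] -/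
theorem cofreeTracePairing_muTwistO_smul [NumberField K] (θ' : absoluteGaloisGroup K →ₜ* (padicCoeffIntegers S)ˣ) (σ : absoluteGaloisGroup K)
    (hσ : ((θ' σ : (padicCoeffIntegers S)ˣ) : padicCoeffIntegers S) * ((θ σ : GL (Fin 1) (padicCoeffIntegers S)) : Matrix (Fin 1) (Fin 1) (padicCoeffIntegers S)) 0 0 = 1)
    (w : OMuCarrier K S (p ^ k)) (m : ↥(torsionPow (Cofree θ (padicCoeffField S)) p k)) :
    (haveI : NeZero (p ^ k) := ⟨pow_ne_zero _ (Fact.out : p.Prime).ne_zero⟩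
     cofreeTracePairing S K θ k (muTwistO S θ' k σ w) (σ • m)) =
      (haveI : NeZero (p ^ k) := ⟨pow_ne_zero _ (Fact.out : p.Prime).ne_zero⟩; mu K (p ^ k) σ (cofreeTracePairing S K θ k w m)) := by
  haveI : NeZero (p ^ k) := ⟨pow_ne_zero _ (Fact.out : p.Prime).ne_zero⟩
  obtain ⟨t, rfl⟩ := exists_divPowTors_eq S K θ k m
  rw [smul_divPowTors_gal, cofreeTracePairing_divPowTors, cofreeTracePairing_divPowTors,
    show ((((θ σ : GL (Fin 1) (padicCoeffIntegers S)) : Matrix (Fin 1) (Fin 1) (padicCoeffIntegers S)) *ᵥ t) 0) =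
      ((θ σ : GL (Fin 1) (padicCoeffIntegers S)) : Matrix (Fin 1) (Fin 1) (padicCoeffIntegers S)) 0 0 * t 0 by
      rw [Matrix.mulVec, dotProduct, Fin.sum_univ_one],
    tracePairing_muTwistO S θ' k σ _ hσ]

end Cofree

end Summit.BirchSwinnertonDyer.BirchSwinnertonDyer.Theorems.SmallImageRttD2Seq

end
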